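import Literature.MathematicalPhysics.QuantumFieldTheory.Balaban1983to89.B9Thm311PerMemberCubeZdTouching
import Literature.MathematicalPhysics.QuantumFieldTheory.Balaban1983to89.B9Eq335PlaquettesOfRegularCubeZd
import Literature.MathematicalPhysics.QuantumFieldTheory.Balaban1983to89.B9Thm311SmallFieldPathZdContinuity

/-!
# `Balaban1983to89.B9Eq335CollarBlindCubeZd` — [Balaban1985BackgroundPropagators] (3.35) p. 396 vs. [Balaban1985RegularSpaces] (1.7) p. 77 AT A CUBE MEMBER
# OF (1.131): THE FRAME'S CLASS (3.35) DOES NOT SEE THE COLLAR — the kernel certificate behind this seat's LOCATED-SELF-6∕7: at every `cubeFam false`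
# member the class `(bgZd …).Reg335 c35 α₀` of the `ℤᵈ` frame contains a unitary background whose plaquette variable is `−1` on a plaquette TOUCHING
# `□₀`, so it is NOT in print's class (1.7) of the member at ANY positive threshold, and the genuine averaging letter `Q*aQ(U₀)` of `opsAllZd` (guarded
# by (1.7)) VANISHES IDENTICALLY there

statement-level skeleton of published theorems with citation tags; proofs where landed; nothing here is a claim about the
Yang–Mills mass gap

`[Balaban1985BackgroundPropagators]` ("B9", CMP **99** (1985) 389–434; journal page = PDF page + 388): (3.35) p. 396 (the class of regular configurations:
a gauge on each cube `□ ⊂ Bʲ(Λ_j) ∪ B^{j+1}(Λ_{j+1})` of the class with `U^u = e^{iηA}`, `|A|, |∂A|` small ON `□`), (3.16) p. 393 (`Q*aQ`), (3.27) p. 395,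
Thm 3.3 p. 399, Thm 3.11 p. 416.  `[Balaban1985RegularSpaces]` ("B8", CMP **99** (1985) 75–102): (1.7) p. 77 («|U(∂p) − 1| < α₀L^{−2j} for p ∈ Ω_j» in
the TOUCHING convention «we denote by Ω also the set of bonds … Similarly for the corresponding set of plaquettes»), (1.33) p. 82, (1.131) p. 99.

CITATION HEADER ∕ WHY THIS FILE (cell `pub-ymgap`, HUMAN RULING D-0062; seat `pub-ymgap-dag-n06-b` (g20), binder∕letter owner of the junction J-N06→N05).
The junction's frame-keyed binders (`InvAt(H)`, `PosDefInClassAtH`, Thm 3.3's block through `B9.Thm33Printed … (bgZd …)`) quantify over the unitary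
backgrounds of the frame class `(bgZd 𝔸 L (memZd M i m)).Reg335 c35 α₀` = r05's `Reg335Zd` on the p. 396 cubes `cubeClass396Zd ⊆ OmTrunc ⊆ Ω₀`.  At a cube
member with `Ω₀ = □₀` finite this class constrains `U₀` ONLY on bonds BASED IN `□₀`; the genuine `Δ_a(U₀)↾E(□₀)` reads the sides of the plaquettes
TOUCHING `□₀` (`B9Eq326DeltaALocalityZdSides`, g20), some based outside.  THIS FILE certifies the gap in kernel: §1 the background `U₀` equal to `−1` on
ONE bond based just outside the lower corner of `□₀` and to `1` elsewhere is unitary, lies in the frame class for EVERY `c35·M·α₀ > 0` (gauge `u = 1`,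
`A = 0` on every class cube — those lie in `□₀`), and has plaquette variable `−1` on a plaquette whose third corner is the lower corner of `□₀`; §2 hence
`¬ Reg17 L m i.Ω α U₀` for every `α ≤ 2` (print's (1.7) at the member FAILS inside the frame class), and the genuine `Q*aQ(U₀)` of this lineage's
`QQZdP` is `0` at every bond (its guard `Reg17 … (α_Q∕L²)` is off, `α_Q ≤ 1`) — so inside the frame class the genuine `Δ_a(U₀)` degenerates to
`D*D + Δ′(U₀) + D R 𝟙 D*` with a plaquette variable at the MAXIMUM of `‖W − 1‖` next to `□₀` (the indefiniteness∕unboundedness mechanism of LOCATED-7,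
whose sign computation through the (3.10) letters is NOT typed here).

WHAT IS PROVED (kernel, 0 sorry, 0 def; no `instance`, no `notation`).
* §1 (private: `neg_one_mem_unitaryUnits`, `norm_neg_one_sub_one` — as in `B8LeafModelZdBoundary`), `cubeClass_subset_omega_zero` (class cubes lie in `Ω₀`),
  ★★ `exists_reg335_plaq_neg_one_cube` (the twisted background: unitary, in the frame class for every `c35·M·α₀ > 0`, plaquette variable `−1` on a plaquette
  touching `□₀`; `d ≥ 2`, `1 ≤ ρ`, `1 ≤ L`).
* §2 ★★★ `exists_reg335_not_reg17_cube` (`∀ α ≤ 2`: the frame class meets `¬ Reg17 L m i.Ω α`), ★★★ `exists_reg335_QQZdP_eq_zero_cube` (… and the genuine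
  `Q*aQ(U₀)` vanishes identically there), ★ `not_forall_reg335_reg17_cube` («(3.35) at the member ⟹ (1.7) at the member» is FALSE).

HONEST SCOPE.  Lattice bookkeeping on one explicit background; certifies the PREMISE of LOCATED-SELF-6∕7 (the frame class is blind to the collar ∕ switches
the genuine `Q*aQ` off), NOT the sign of the form there; no estimate; count-neutral helper of K1⁸ (`--supports stmt-QuantumFields-26907`); N05∕N06 NOT
discharged; one finite `𝕋⁴` programme at fixed `ε`, Bałaban as printed; R4 closes only the conditional finite-`𝕋⁴` rung `BalabanLadder.UV` — nothing
continuum ∕ `ℝ⁴` ∕ OS ∕ mass gap ∕ Clay.  Unit `pub-ymgap-dag-n06-b` (g20), 2026-08-28.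
-/

noncomputable section

open scoped BigOperators
open NormedSpace

namespace Literature.MathematicalPhysics.QuantumFieldTheory.Balaban1983to89.B9Eq335CollarBlindCubeZd

open B7Prop1Explicit (e hol plaqWord gaugeAct U1)
open B7Prop1Local (InBox)
open B7Prop2Explicit (unitaryUnits unitaryUnits_le_U1)
open B8Ineq132 (PlaqTouches BondTouches plaqF)
open B8Eq133Hypotheses (shiftT byDir byDir_apply Reg335Zd reg335Zd_iff fluct_zero)
open B8Eq131Cubes (cube sqLo sqHi)
open B8Eq131CubesAdmissible (cubeFam cubeFam_false_zero cubeFam_false_of_le)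
open B8Ineq159FlatCubeMemberKernel (mem_cube_zero_iff)
open B8LeafModelZd (ZdIdx)
open B9SupplySockB9P3ZdFrame (MemberZd bgZd memZd ιCfgZd cubeClass396Zd OmTrunc omTrunc_of_le cubeClass396Zd_index reg335_bgZd_mem_iff memZd_i memZd_m)
open B9SupplySockB9P3ZdLettersOmega (omega_subset_of_le)
open B9Eq316AveragingTransposeZd (Reg17 alphaQ alphaQ_pos)
open B9Eq316AveragingTransposeZdPrinted (QQZdP QQZdP_of_not_reg17)
open B9Eq335PlaquettesOfRegularCubeZd (hol_plaqWord_eq)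
open B9Thm311PerMemberCubeZdTouching (sqLo_le_sqHi_zero)
open LatticeNorms (scaleLen scaleLen_pos)

export B7Prop1Explicit (Site)

variable {d : ℕ}

/-! ## §1 The twisted background -/

section Twist

variable {𝔸 : Type*} [CStarAlgebra 𝔸]

/-- `−1` is a unitary unit. [cite: Balaban1985BackgroundPropagators, p.390 («unitary group U(N)», bookkeeping)] -/
private theorem neg_one_mem_unitaryUnits : (-1 : 𝔸ˣ) ∈ unitaryUnits 𝔸 := by
  show (((-1 : 𝔸ˣ)) : 𝔸) ∈ unitary 𝔸
  rw [Units.val_neg, Units.val_one, Unitary.mem_iff]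
  simp

/-- `‖(−1) − 1‖ = 2` in a nontrivial C*-algebra (the MAXIMUM of `‖W − 1‖` over unitaries). [cite: Balaban1985RegularSpaces, (1.7) p.77 (bookkeeping)] -/
private theorem norm_neg_one_sub_one [Nontrivial 𝔸] : ‖(-1 : 𝔸) - 1‖ = 2 := by
  have h : (-1 : 𝔸) - 1 = -((2 : ℝ) • (1 : 𝔸)) := by rw [two_smul]; abel
  rw [h, norm_neg, norm_smul, norm_one, mul_one, Real.norm_eq_abs, abs_of_pos (by norm_num : (0 : ℝ) < 2)]

variable {L : ℕ}

omit [CStarAlgebra 𝔸] in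
/-- the cubes of the p. 396 class of a member lie in its `Ω₀`. [cite: Balaban1985BackgroundPropagators, p.396 («□ ⊂ Bʲ(Λ_j) ∪ B^{j+1}(Λ_{j+1})»)] -/
theorem cubeClass_subset_omega_zero (x : MemberZd d L) {q : Set (Site d) × ℕ} (hq : q ∈ cubeClass396Zd L x) : q.1 ⊆ x.i.Ω 0 := by
  have hj : q.2 ≤ x.m := cubeClass396Zd_index hq
  have h1 : q.1 ⊆ OmTrunc x q.2 := hq.2.2.1
  rw [omTrunc_of_le x hj] at h1
  exact h1.trans (omega_subset_of_le x.i (Nat.zero_le _))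

end Twist

section Frame

variable {𝔸 : Type} [CStarAlgebra 𝔸] [Nontrivial 𝔸] {L : ℕ}

/-- ★★ **THE TWISTED BACKGROUND**: at a cube member (`Ω = cubeFam false L a Mc ρ k`, `1 ≤ ρ`, `1 ≤ L`, `2 ≤ d`), for every `c35·M·α₀ > 0`, there is a
unitary `U₀` IN THE FRAME CLASS `(bgZd …).Reg335 c35 α₀` whose plaquette variable on a plaquette TOUCHING `□₀` (third corner = the lower corner of `□₀`) is
`−1`: `U₀ = −1` on the one bond `⟨sqLo₀ − e₁, sqLo₀ − e₁ + e₀⟩` (based outside `□₀`), `= 1` elsewhere; the gauge `u = 1`, `A = 0` exhibits (3.35) on every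
class cube (they lie in `□₀`). [cite: Balaban1985BackgroundPropagators, (3.35) p.396; Balaban1985RegularSpaces, (1.7) p.77, (1.131) p.99] -/
theorem exists_reg335_plaq_neg_one_cube (hd2 : 2 ≤ d) (hL : 1 ≤ L) (M : ℝ) (i : ZdIdx d L)
    {a : Site d} {Mc ρ : ℕ} (hρ : 1 ≤ ρ) (hΩ : i.Ω = cubeFam false L a Mc ρ i.k) (m : ℕ) {c35 α₀ : ℝ} (hc : 0 < c35 * M * α₀) :
    ∃ (U₀ : Site d → Fin d → 𝔸ˣ) (hU₀ : ∀ x κ, U₀ x κ ∈ unitaryUnits 𝔸),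
      (bgZd 𝔸 L (memZd M i m)).Reg335 c35 α₀ (ιCfgZd 𝔸 L M i m U₀ hU₀) ∧
        ∃ (z : Site d) (μ ν : Fin d), μ ≠ ν ∧ PlaqTouches (i.Ω 0) z μ ν ∧ plaqF U₀ μ ν z = -1 := by
  classical
  -- two directions
  obtain ⟨μ, ν, hμν⟩ : ∃ μ ν : Fin d, μ ≠ ν := ⟨⟨0, by omega⟩, ⟨1, by omega⟩, by simp [Fin.ext_iff]⟩
  -- the lower corner `x₀` of `□₀` and the site `z = x₀ − e_ν` just outside
  obtain ⟨x₀, hx₀_def⟩ : ∃ x₀ : Site d, x₀ = sqLo L a ρ i.k 0 := ⟨_, rfl⟩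
  have hx₀ : x₀ ∈ i.Ω 0 := by
    rw [hΩ, cubeFam_false_zero, mem_cube_zero_iff, hx₀_def]
    exact fun i' => ⟨le_rfl, sqLo_le_sqHi_zero L a Mc hρ i.k i'⟩
  obtain ⟨z, hz_def⟩ : ∃ z : Site d, z = x₀ - e ν := ⟨_, rfl⟩
  have hz : z ∉ i.Ω 0 := by
    rw [hΩ, cubeFam_false_zero, mem_cube_zero_iff]
    intro h
    have h1 := (h ν).1
    rw [hz_def, Pi.sub_apply, B7Prop1Explicit.e_apply, if_pos rfl, hx₀_def] at h1
    linarith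
  -- the background
  obtain ⟨U₀, hU₀_def⟩ : ∃ U₀ : Site d → Fin d → 𝔸ˣ, U₀ = fun y κ => if y = z ∧ κ = μ then -1 else 1 := ⟨_, rfl⟩
  have hU₀u : ∀ y κ, U₀ y κ ∈ unitaryUnits 𝔸 := by
    intro y κ; rw [hU₀_def]; dsimp only
    split_ifs
    · exact neg_one_mem_unitaryUnits
    · exact (unitaryUnits 𝔸).one_mem
  have hU₀_one : ∀ (y : Site d) (κ : Fin d), y ≠ z → U₀ y κ = 1 := by
    intro y κ hy; rw [hU₀_def]; dsimp only; rw [if_neg (fun h => hy h.1)]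
  have hU₀_dir : ∀ κ : Fin d, κ ≠ μ → U₀ z κ = 1 := by
    intro κ hκ; rw [hU₀_def]; dsimp only; rw [if_neg (fun h => hκ h.2)]
  have hU₀_b : U₀ z μ = -1 := by rw [hU₀_def]; dsimp only; rw [if_pos ⟨rfl, rfl⟩]
  refine ⟨U₀, hU₀u, ?_, z, μ, ν, hμν, ?_, ?_⟩
  · -- (3.35) on every class cube with `u = 1`, `A = 0`
    rw [reg335_bgZd_mem_iff, reg335Zd_iff]
    intro q hq
    have hq0 : q.1 ⊆ i.Ω 0 := by
      have h := cubeClass_subset_omega_zero (memZd M i m) hq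
      rwa [memZd_i] at h
    have hη : 0 < i.η := i.hη
    have hLr : (0 : ℝ) < (L : ℝ) := by exact_mod_cast hL
    have hξ : 0 < scaleLen (L : ℝ) i.η q.2 := scaleLen_pos hLr hη q.2
    refine ⟨1, 0, fun z' _ => ⟨by simp, by simp⟩, fun κ z' hz' => ?_, fun κ z' _ => ?_, fun κ ν' z' _ => ?_⟩
    · have hne : z' ≠ z := fun h => hz (h ▸ hq0 hz')
      rw [fluct_zero]
      simp only [byDir_apply, gaugeAct, Pi.one_apply, one_mul, inv_one, mul_one]
      exact hU₀_one z' κ hne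
    · simp only [Pi.zero_apply, norm_zero]
      positivity
    · have h0 : B9Eq39Adjoint.covD (shiftT d) (fun _ _ => (1 : 𝔸ˣ)) κ ((0 : Fin d → Site d → 𝔸) ν') z' = 0 := B9Eq39Adjoint.covD_zero _ _ κ z'
      rw [h0, smul_zero, norm_zero]
      positivity
  · -- the plaquette `p_{μν}(z)` touches `□₀` through its third corner `z + e_ν = x₀`
    refine Or.inr (Or.inr (Or.inl ?_))
    rw [hz_def, sub_add_cancel]; exact hx₀
  · -- its plaquette variable is `−1`
    have hzμ : z + e μ ≠ z := by
      intro h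
      have := congrArg (fun v => v μ) h
      simp [B7Prop1Explicit.e_apply] at this
    have hzν : z + e ν ≠ z := by
      intro h
      have := congrArg (fun v => v ν) h
      simp [B7Prop1Explicit.e_apply] at this
    unfold plaqF
    rw [hol_plaqWord_eq, hU₀_b, hU₀_one _ ν hzμ, hU₀_one _ μ hzν, hU₀_dir ν hμν.symm]
    simp

end Frame

/-! ## §2 (3.35) at the member does not imply (1.7) at the member; the genuine `Q*aQ` switches off inside the frame class -/

section Collar

variable {𝔸 : Type} [CStarAlgebra 𝔸] [Nontrivial 𝔸] {L : ℕ}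

/-- ★★★ **THE FRAME CLASS MEETS THE COMPLEMENT OF PRINT'S CLASS (1.7) OF THE MEMBER**: for every threshold `α ≤ 2` and every `c35·M·α₀ > 0`, some unitary
`U₀` with `(bgZd …).Reg335 c35 α₀ U₀` has `¬ Reg17 L m i.Ω α U₀` (a plaquette touching `□₀` with `‖U₀(∂p) − 1‖ = 2`).
[cite: Balaban1985BackgroundPropagators, (3.35) p.396; Balaban1985RegularSpaces, (1.7) p.77, (1.33) p.82, (1.131) p.99] -/
theorem exists_reg335_not_reg17_cube (hd2 : 2 ≤ d) (hL : 1 ≤ L) (M : ℝ) (i : ZdIdx d L)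
    {a : Site d} {Mc ρ : ℕ} (hρ : 1 ≤ ρ) (hΩ : i.Ω = cubeFam false L a Mc ρ i.k) (m : ℕ) {c35 α₀ : ℝ} (hc : 0 < c35 * M * α₀)
    {α : ℝ} (hα : α ≤ 2) :
    ∃ (U₀ : Site d → Fin d → 𝔸ˣ) (hU₀ : ∀ x κ, U₀ x κ ∈ unitaryUnits 𝔸),
      (bgZd 𝔸 L (memZd M i m)).Reg335 c35 α₀ (ιCfgZd 𝔸 L M i m U₀ hU₀) ∧ ¬ Reg17 L m i.Ω α U₀ := by
  obtain ⟨U₀, hU₀, hreg, z, μ, ν, hμν, hpt, hF⟩ := exists_reg335_plaq_neg_one_cube (𝔸 := 𝔸) hd2 hL M i hρ hΩ m hc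
  refine ⟨U₀, hU₀, hreg, fun h17 => ?_⟩
  have h := h17 0 (Nat.zero_le m) z μ ν hμν hpt
  rw [hF, norm_neg_one_sub_one, pow_zero, inv_one, one_pow, mul_one] at h
  linarith

/-- ★★★ **INSIDE THE FRAME CLASS THE GENUINE `Q*aQ(U₀)` VANISHES IDENTICALLY AT SOME BACKGROUND** (`L ≥ 1`: the guard window `α_Q∕L² ≤ 1 ≤ 2` is missed):
some unitary `U₀` with `(bgZd …).Reg335 c35 α₀ U₀` has `QQZdP τ L ΛbP i m U₀ A = 0` for EVERY field `A` — so there the genuine `Δ_a(U₀)` of `opsAllZd`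
is `D*D + Δ′(U₀) + D R 𝟙 D*` with a plaquette variable `−1` next to `□₀`. [cite: Balaban1985BackgroundPropagators, (3.16) p.393, (3.35) p.396, (3.26) p.395; Balaban1985RegularSpaces, (1.7) p.77] -/
theorem exists_reg335_QQZdP_eq_zero_cube [FiniteDimensional ℝ 𝔸] (τ : 𝔸 →ₗ[ℂ] ℂ) (ΛbP : ℕ → ℕ → Set (Site d × Fin d))
    (hd2 : 2 ≤ d) (hL : 1 ≤ L) (M : ℝ) (i : ZdIdx d L)
    {a : Site d} {Mc ρ : ℕ} (hρ : 1 ≤ ρ) (hΩ : i.Ω = cubeFam false L a Mc ρ i.k) (m : ℕ) {c35 α₀ : ℝ} (hc : 0 < c35 * M * α₀) :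
    ∃ (U₀ : Site d → Fin d → 𝔸ˣ) (hU₀ : ∀ x κ, U₀ x κ ∈ unitaryUnits 𝔸),
      (bgZd 𝔸 L (memZd M i m)).Reg335 c35 α₀ (ιCfgZd 𝔸 L M i m U₀ hU₀) ∧
        (¬ Reg17 L m i.Ω (alphaQ d L / (L : ℝ) ^ 2) U₀) ∧
        ∀ (A : Site d → Fin d → 𝔸) (y : Site d) (μ : Fin d), QQZdP τ L ΛbP i m U₀ A y μ = 0 := by
  have hLr : (1 : ℝ) ≤ L := by exact_mod_cast hL
  have hwin : alphaQ d L / (L : ℝ) ^ 2 ≤ 2 := by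
    have h1 : alphaQ d L ≤ 1 := B9Thm311SmallFieldPathZdContinuity.alphaQ_le_one d hL
    have h2 : (1 : ℝ) ≤ (L : ℝ) ^ 2 := one_le_pow₀ hLr
    have h3 : alphaQ d L / (L : ℝ) ^ 2 ≤ alphaQ d L := div_le_self (alphaQ_pos d hL).le h2
    linarith
  obtain ⟨U₀, hU₀, hreg, h17⟩ := exists_reg335_not_reg17_cube (𝔸 := 𝔸) hd2 hL M i hρ hΩ m hc hwin
  exact ⟨U₀, hU₀, hreg, h17, fun A y μ => QQZdP_of_not_reg17 τ L h17 A y μ⟩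

/-- ★ **«(3.35) AT THE MEMBER ⟹ (1.7) AT THE MEMBER» IS FALSE** at every cube member, for every frame constant `c35·M·α₀ > 0` and every (1.7)-threshold `α ≤ 2`.
[cite: Balaban1985BackgroundPropagators, (3.35) p.396; Balaban1985RegularSpaces, (1.7) p.77, (1.33) p.82] -/
theorem not_forall_reg335_reg17_cube (hd2 : 2 ≤ d) (hL : 1 ≤ L) (M : ℝ) (i : ZdIdx d L)
    {a : Site d} {Mc ρ : ℕ} (hρ : 1 ≤ ρ) (hΩ : i.Ω = cubeFam false L a Mc ρ i.k) (m : ℕ) {c35 α₀ : ℝ} (hc : 0 < c35 * M * α₀)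
    {α : ℝ} (hα : α ≤ 2) :
    ¬ ∀ (U₀ : Site d → Fin d → 𝔸ˣ) (hU₀ : ∀ x κ, U₀ x κ ∈ unitaryUnits 𝔸),
      (bgZd 𝔸 L (memZd M i m)).Reg335 c35 α₀ (ιCfgZd 𝔸 L M i m U₀ hU₀) → Reg17 L m i.Ω α U₀ := by
  intro h
  obtain ⟨U₀, hU₀, hreg, h17⟩ := exists_reg335_not_reg17_cube (𝔸 := 𝔸) hd2 hL M i hρ hΩ m hc hα
  exact h17 (h U₀ hU₀ hreg)

end Collar

end Literature.MathematicalPhysics.QuantumFieldTheory.Balaban1983to89.B9Eq335CollarBlindCubeZd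

end
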